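import Summits.QuantumFields.YangMills.Theorems.UV3AxialLaunderingFreeSlot
import HarnessLib

/-!
# R3 (cell `ym3-torus`, YM₃ on T³ — a ladder RUNG, NOT d = 4, NOT infinite volume, NOT a mass gap, NOT the Clay problem) —
# **FRESH OVERWRITE ALONG THE AXIAL REFERENCE FOR AN ARBITRARY INPUT LAW: if a law `ν` on the level-`j` fields is invariant under
# right-multiplying one chosen bond of every segment of a set `Λ`, then under ANY map that is the straight transporter on `Λ` the
# `Λ`-coordinates are FRESH product Haar — independent of a slot-blind spectator and of the other coordinates; two such laws with the
# same off-`Λ` marginal have the same image (COUPLING), and the invariance reproduces itself on the image (it ITERATES)**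

Width seat `ym-ust-19936-w8` g12 on crux `stmt-QuantumFields-19936` `UnitScaleTilt.HistoryTailL` (`--supports`, helper; THEOREMS ONLY, 0 `def`, 0 `sorry`).
Sequel of ✓`UV3AxialLaunderingFreeSlot` (px8 g12, p755566), whose slot shear `U ↦ U·ext(k)`, `line_inj`, `exists_axialAvg_shear` and `measurable_shear` are used
BY NAME with the `Λ`-MASKED coarse field `Λ.mulIndicator k` (value `k c` at the slot of `c ∈ Λ`, `1` at every other bond).

WHY (hTop bookkeeping, `N08-HJ-LOOPPART-DESIGN-g47.md` §2 (R1)∕(R2), milestones (M4)∕(M5)).  Every laundering theorem in the tree takes the INPUT law to be a density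
`f·dU_j` against product Haar (✓`…FreeSlot`, ✓`…FreeSlotSpectator`, ✓`BalabanUVNodesN08AxialLaundering*`, ✓`…N08AxialDecimationFarFresh`, ✓`…N08CoarseGrainingFarFresh`,
✓`…N08HaarCompatibilityGuardHybridFresh`).  In the cross-level bookkeeping the input at level `k > j` is an ITERATE `(Ū^{S_{k−1}}∘⋯)_*(…)`, not of that form.  What
transports level-to-level is SHEAR-INVARIANCE — «`ν` is invariant under right-multiplying the slot bond of every segment in `Λ`»: it holds for `dU_j`, survives
`withDensity` of a slot-blind density and pushforwards intertwining the shear, and is REPRODUCED on the laundered coordinates of the image (both in the sequel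
`UV3AxialLaunderingOverwritePropagate`).  The COUPLING (§2) is the sentence in which a one-site defect `(Ū^{S∪{x}})_*ρ − (Ū^S)_*ρ` (two laws agreeing off the bond `x`, §0) DIES one level up when the segment through `x`
keeps a free slot.

THE ARGUMENT ([folklore]; px8's Tonelli argument for a general `ν` and a general test function).  `∫ g(φ U, Φ U) dν = ∫ g(φ(U·ext k), Φ(U·ext k)) dν` for every masked
`k` (invariance); `φ(U·ext k) = φ U` (slot-blind) and `Φ(U·ext k) = Λ.piecewise (A·k·B) (Φ U)` (`exists_axialAvg_shear` on `Λ`, slot-blindness off `Λ`); average over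
`k ∼ dU_{j+1}`, swap (Tonelli), remove `A`, `B` by two-sided translation invariance of `dU_{j+1}`; what is left is the overwrite integral.

CONTENTS.  §0 `map_map_eq_of_agree_off`.  §1 the masked shear: `extend_mask_of_not_slot`, `shear_mask_apply_of_not_slot`, ★ `comp_shear_mask_eq_piecewise`,
`measurable_mulIndicator_mask`, `measurable_shear_mask`, `measurable_piecewise_overwrite`.  §2 ★★★ `map_prod_eq_overwrite` — **`ν.map (U ↦ (φ U, Φ U)) =
(ν ⊗ dU_{j+1}).map ((U, k) ↦ (φ U, Λ.piecewise k (Φ U)))`**; ★★ `map_prod_eq_overwrite_marginal`; ★★ `map_prod_eq_of_marginal_eq` (COUPLING); `map_eq_overwrite` ∕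
`map_eq_of_marginal_eq` (no spectator).  Argument order of §2: `hj t ht Λ hΦ hΦΛ hΦoff ν hν [hφ hφoff]`.  Sequel `UV3AxialLaunderingOverwritePropagate`: freshness
propagates to the image (`map_map_mulRight_mask_eq`) + producers of the shear hypothesis (`dU_j`, `withDensity`, `restrict`, intertwined pushforwards).

HONEST SCOPE.  [folklore] measure theory on the lit objects `AveragingRT.axialAvg`∕`line`∕`fieldMeasure`; N08-vocabulary-free (the hybrids `Ū^S` are consumers'
instances of `Φ`); a TOOL for (M4)∕(M5), not (M4); hTop, (a)′∀, hJ, `stub_hJ`, `stub_laneRecordsV3`, `HistoryTailL` (19936), the rung `YM3TorusSU2`, any continuum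
limit, d = 4, a mass gap or Clay are NOT proved here.  YM₃ on T³ is rung R3 of the ladder, not the Clay problem.

References: T. Bałaban, Commun. Math. Phys. **109** (1987) 249–301 [Balaban1987RG1] ((0.4) p. 253); T. Bałaban, Commun. Math. Phys. **98** (1985) 17–51
[Balaban1985Averaging] ((10) p. 19 product Haar `dU`, (b) p. 23 Haar compatibility); T. Bałaban, Commun. Math. Phys. **95** (1984) 17–40 [Balaban1984PropagatorsI] ((1.7) p. 18).
-/

set_option autoImplicit false

noncomputable section

open MeasureTheory
open scoped ENNReal

namespace Summit.QuantumFields.YangMills.Theorems.UV3AxialLaunderingOverwrite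

open Literature.MathematicalPhysics.QuantumFieldTheory.Balaban1983to89
open Literature.MathematicalPhysics.QuantumFieldTheory.Balaban1983to89.AveragingRT
open Summit.QuantumFields.YangMills.Theorems.UV3AxialLaunderingFreeSlot

/-! ## §0 Producer of the coupling hypothesis: maps agreeing off a bond set -/
section AgreeOff

variable {X Z : Type*} [MeasurableSpace X] [MeasurableSpace Z] {P : Params} {j : ℕ} {G : Type*} [MeasurableSpace G]

/-- **MAPS AGREEING OFF `D` HAVE EQUAL `D`-BLIND MARGINALS**: if `T₁ x` and `T₂ x` agree at every bond outside `D` (toggling guards supported in `D` is the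
intended instance) and `ψ` does not read `D`, then `(μ∘T₁⁻¹)∘ψ⁻¹ = (μ∘T₂⁻¹)∘ψ⁻¹`. [folklore] -/
theorem map_map_eq_of_agree_off (μ : Measure X) (D : Set (PBond P j)) {T₁ T₂ : X → GaugeField P j G}
    (hT₁ : Measurable T₁) (hT₂ : Measurable T₂) (hagree : ∀ x b, b ∉ D → T₁ x b = T₂ x b)
    {ψ : GaugeField P j G → Z} (hψ : Measurable ψ) (hblind : ∀ U U' : GaugeField P j G, (∀ b, b ∉ D → U b = U' b) → ψ U = ψ U') :
    (μ.map T₁).map ψ = (μ.map T₂).map ψ := by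
  rw [Measure.map_map hψ hT₁, Measure.map_map hψ hT₂]
  exact congrArg (fun f : X → Z => μ.map f) (show ψ ∘ T₁ = ψ ∘ T₂ from funext fun x => hblind _ _ fun b hb => hagree x b hb)

end AgreeOff

/-! ## §1 The `Λ`-masked slot shear -/
section Mask

variable {P : Params} {j : ℕ} {G : Type*} [GaugeGroup G]
  (hj : j + 1 ≤ P.m + P.K) (t : PBond P (j + 1) → ℕ) (ht : ∀ c, t c < P.L) (Λ : Set (PBond P (j + 1)))

include hj ht in
/-- Off the slots of the segments in `Λ`, the masked extended field is `1`. [folklore] -/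
theorem extend_mask_of_not_slot (k : GaugeField P (j + 1) G) {b : PBond P j} (hb : ¬ ∃ c ∈ Λ, line c (t c) = b) :
    Function.extend (fun c : PBond P (j + 1) => line c (t c)) (Λ.mulIndicator k) (fun _ => 1) b = 1 := by
  by_cases h : ∃ c : PBond P (j + 1), line c (t c) = b
  · obtain ⟨c, rfl⟩ := h
    rw [extend_slot_apply hj t ht]
    exact Set.mulIndicator_of_notMem (fun hc => hb ⟨c, hc, rfl⟩) k
  · exact Function.extend_apply' _ _ _ h

include hj ht in
/-- The masked shear `U ↦ U·ext(Λ.mulIndicator k)` changes only the slot bonds of the segments in `Λ`. [folklore] -/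
theorem shear_mask_apply_of_not_slot (k : GaugeField P (j + 1) G) (U : GaugeField P j G) {b : PBond P j}
    (hb : ¬ ∃ c ∈ Λ, line c (t c) = b) :
    U b * Function.extend (fun c : PBond P (j + 1) => line c (t c)) (Λ.mulIndicator k) (fun _ => 1) b = U b := by
  rw [extend_mask_of_not_slot hj t ht Λ k hb, mul_one]

include hj ht in
/-- ★ **THE SHEARED MAP IS AN OVERWRITE**: if `Φ` is the straight transporter on the `Λ`-coordinates and its other coordinates do not read the `Λ`-slots, then for
fixed `U` there are coarse fields `A`, `B` with `Φ(U·ext(Λ.mulIndicator k)) = Λ.piecewise (A·k·B) (Φ U)` for every `k`. [cite: Balaban1984PropagatorsI, (1.7) p.18] -/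
theorem comp_shear_mask_eq_piecewise [DecidablePred (· ∈ Λ)] {Φ : GaugeField P j G → GaugeField P (j + 1) G}
    (hΦΛ : ∀ U, ∀ c ∈ Λ, Φ U c = axialAvg U c)
    (hΦoff : ∀ U U' : GaugeField P j G, (∀ b, (¬ ∃ c ∈ Λ, line c (t c) = b) → U b = U' b) → ∀ c, c ∉ Λ → Φ U c = Φ U' c)
    (U : GaugeField P j G) :
    ∃ A B : GaugeField P (j + 1) G, ∀ k : GaugeField P (j + 1) G,
      Φ (fun b => U b * Function.extend (fun c : PBond P (j + 1) => line c (t c)) (Λ.mulIndicator k) (fun _ => 1) b) =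
        (Λ.piecewise (fun c => A c * k c * B c) (Φ U) : GaugeField P (j + 1) G) := by
  obtain ⟨A, B, hAB⟩ := exists_axialAvg_shear hj t ht U
  refine ⟨A, B, fun k => funext fun c => ?_⟩
  by_cases hc : c ∈ Λ
  · rw [Set.piecewise_eq_of_mem _ _ _ hc, hΦΛ _ c hc, hAB (Λ.mulIndicator k)]
    simp only [Set.mulIndicator_of_mem hc]
  · rw [Set.piecewise_eq_of_notMem _ _ _ hc]
    exact hΦoff _ _ (fun b hb => shear_mask_apply_of_not_slot hj t ht Λ k U hb) c hc

variable [MeasurableSpace G]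

/-- The mask `k ↦ Λ.mulIndicator k` is measurable. [folklore] -/
theorem measurable_mulIndicator_mask :
    @Measurable (GaugeField P (j + 1) G) (GaugeField P (j + 1) G) _ _ fun k => Λ.mulIndicator k := by
  refine measurable_pi_iff.mpr fun c => ?_
  by_cases hc : c ∈ Λ
  · have h : (fun k : GaugeField P (j + 1) G => Λ.mulIndicator k c) = fun k => k c :=
      funext fun k => Set.mulIndicator_of_mem hc k
    rw [h]; exact measurable_pi_apply c
  · have h : (fun k : GaugeField P (j + 1) G => Λ.mulIndicator k c) = fun _ => 1 :=
      funext fun k => Set.mulIndicator_of_notMem hc k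
    rw [h]; exact measurable_const

omit [GaugeGroup G] in
/-- The overwrite `w ↦ Λ.piecewise (k w) (V w)` is measurable when `k`, `V` are. [folklore] -/
theorem measurable_piecewise_overwrite [DecidablePred (· ∈ Λ)] {W : Type*} [MeasurableSpace W]
    {V : W → GaugeField P (j + 1) G} (hV : Measurable V) {k : W → GaugeField P (j + 1) G} (hk : Measurable k) :
    @Measurable W (GaugeField P (j + 1) G) _ _ fun w => Λ.piecewise (k w) (V w) := by
  refine measurable_pi_iff.mpr fun c => ?_
  by_cases hc : c ∈ Λ
  · have h : (fun w => Λ.piecewise (k w) (V w) c) = fun w => k w c := funext fun w => Set.piecewise_eq_of_mem _ _ _ hc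
    rw [h]; exact (measurable_pi_apply c).comp hk
  · have h : (fun w => Λ.piecewise (k w) (V w) c) = fun w => V w c := funext fun w => Set.piecewise_eq_of_notMem _ _ _ hc
    rw [h]; exact (measurable_pi_apply c).comp hV

variable [MeasurableMul₂ G]

include hj ht in
/-- The masked shear `(U, k) ↦ U·ext(Λ.mulIndicator k)` is jointly measurable. [folklore] -/
theorem measurable_shear_mask :
    @Measurable (GaugeField P j G × GaugeField P (j + 1) G) (GaugeField P j G) _ _ fun p =>
      fun b => p.1 b * Function.extend (fun c : PBond P (j + 1) => line c (t c)) (Λ.mulIndicator p.2) (fun _ => 1) b :=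
  (measurable_shear hj t ht).comp (measurable_fst.prodMk ((measurable_mulIndicator_mask Λ).comp measurable_snd))

end Mask

/-! ## §2 The overwrite formula and the coupling -/
section Overwrite

variable {P : Params} {j : ℕ} {G : Type*} [GaugeGroup G] [MeasurableSpace G] [HaarData G] [MeasurableMul₂ G]
  {Y : Type*} [MeasurableSpace Y]
  (hj : j + 1 ≤ P.m + P.K) (t : PBond P (j + 1) → ℕ) (ht : ∀ c, t c < P.L) (Λ : Set (PBond P (j + 1))) [DecidablePred (· ∈ Λ)]
  {Φ : GaugeField P j G → GaugeField P (j + 1) G} (hΦ : Measurable Φ) (hΦΛ : ∀ U, ∀ c ∈ Λ, Φ U c = axialAvg U c)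
  (hΦoff : ∀ U U' : GaugeField P j G, (∀ b, (¬ ∃ c ∈ Λ, line c (t c) = b) → U b = U' b) → ∀ c, c ∉ Λ → Φ U c = Φ U' c)

include hj ht hΦ hΦΛ hΦoff

/-- ★★★ **FRESH OVERWRITE FOR AN ARBITRARY INVARIANT INPUT LAW.**  Slots `t(c) < L`; a set `Λ` of coarse bonds; a measurable `Φ` into the level-`(j+1)` fields which IS
the straight transporter `axialAvg` on the `Λ`-coordinates and whose other coordinates do not read the `Λ`-slots; an s-finite law `ν` on the level-`j` fields invariant
under the masked shear `U ↦ U·ext(Λ.mulIndicator k)` for EVERY coarse field `k` (right-multiplication of the slot bond of each segment in `Λ`); a measurable spectator `φ`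
not reading the `Λ`-slots.  Then `ν.map (U ↦ (φ U, Φ U)) = (ν ⊗ dU_{j+1}).map ((U, k) ↦ (φ U, Λ.piecewise k (Φ U)))`: under `ν` the `Λ`-coordinates of `Φ` are FRESH
product Haar, independent of `φ` and of the other coordinates (standing range).  `ν = f·dU_j`, `Λ` = everything is ✓`UV3AxialLaunderingFreeSlotSpectator`; here `ν`
may be any iterate. [cite: Balaban1987RG1, (0.4) p.253; Balaban1985Averaging, (10) p.19] -/
theorem map_prod_eq_overwrite (ν : Measure (GaugeField P j G)) [SFinite ν]
    (hν : ∀ k : GaugeField P (j + 1) G,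
      ν.map (fun U b => U b * Function.extend (fun c : PBond P (j + 1) => line c (t c)) (Λ.mulIndicator k) (fun _ => 1) b) = ν)
    {φ : GaugeField P j G → Y} (hφ : Measurable φ)
    (hφoff : ∀ U U' : GaugeField P j G, (∀ b, (¬ ∃ c ∈ Λ, line c (t c) = b) → U b = U' b) → φ U = φ U') :
    ν.map (fun U => (φ U, Φ U)) =
      ((ν.prod (fieldMeasure P (j + 1) G)).map
        (fun p : GaugeField P j G × GaugeField P (j + 1) G => (φ p.1, Λ.piecewise p.2 (Φ p.1))) :
          Measure (Y × GaugeField P (j + 1) G)) := by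
  have hSm := measurable_shear_mask hj t ht Λ (G := G)
  have hpair : Measurable fun U : GaugeField P j G => (φ U, Φ U) := hφ.prodMk hΦ
  have hover : @Measurable (GaugeField P j G × GaugeField P (j + 1) G) (Y × GaugeField P (j + 1) G) _ _
      fun p => (φ p.1, Λ.piecewise p.2 (Φ p.1)) :=
    (hφ.comp measurable_fst).prodMk (measurable_piecewise_overwrite Λ (hΦ.comp measurable_fst) measurable_snd)
  have hφS : ∀ (U : GaugeField P j G) (k : GaugeField P (j + 1) G),
      φ (fun b => U b * Function.extend (fun c : PBond P (j + 1) => line c (t c)) (Λ.mulIndicator k) (fun _ => 1) b) = φ U :=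
    fun U k => hφoff _ _ fun b hb => shear_mask_apply_of_not_slot hj t ht Λ k U hb
  refine Measure.ext_of_lintegral _ fun I hIm => ?_
  -- the sheared integrand
  set F : GaugeField P j G → GaugeField P (j + 1) G → ℝ≥0∞ := fun U k =>
    I (φ U, Φ (fun b => U b * Function.extend (fun c : PBond P (j + 1) => line c (t c)) (Λ.mulIndicator k) (fun _ => 1) b)) with hF
  have hFm : Measurable (Function.uncurry F) := hIm.comp ((hφ.comp measurable_fst).prodMk (hΦ.comp hSm))
  have hFm' : Measurable (Function.uncurry fun (k : GaugeField P (j + 1) G) (U : GaugeField P j G) => F U k) :=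
    hFm.comp measurable_swap
  -- (i) invariance under the masked shear: the value does not depend on `k`
  have hstep : ∀ k : GaugeField P (j + 1) G, ∫⁻ U, F U k ∂ν = ∫⁻ U, I (φ U, Φ U) ∂ν := by
    intro k
    have hSk : @Measurable (GaugeField P j G) (GaugeField P j G) _ _ fun U =>
        fun b => U b * Function.extend (fun c : PBond P (j + 1) => line c (t c)) (Λ.mulIndicator k) (fun _ => 1) b :=
      hSm.comp (measurable_id.prodMk measurable_const)
    have e1 : ∫⁻ U, F U k ∂ν =
        ∫⁻ U, I (φ (fun b => U b * Function.extend (fun c : PBond P (j + 1) => line c (t c)) (Λ.mulIndicator k) (fun _ => 1) b),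
          Φ (fun b => U b * Function.extend (fun c : PBond P (j + 1) => line c (t c)) (Λ.mulIndicator k) (fun _ => 1) b)) ∂ν := by
      simp only [hF, hφS]
    have e2 := lintegral_map (μ := ν) (hIm.comp hpair) hSk
    have e3 : ((ν.map fun (U : GaugeField P j G) (b : PBond P j) =>
        U b * Function.extend (fun c : PBond P (j + 1) => line c (t c)) (Λ.mulIndicator k) (fun _ => 1) b) :
          Measure (GaugeField P j G)) = ν := hν k
    rw [e3] at e2
    exact e1.trans e2.symm
  -- (ii) average over `k`
  have havg : ∫⁻ U, I (φ U, Φ U) ∂ν = ∫⁻ k, ∫⁻ U, F U k ∂ν ∂(fieldMeasure P (j + 1) G) := by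
    simp_rw [hstep]
    rw [lintegral_const, measure_univ, mul_one]
  -- (iii) the inner integral for fixed `U`: remove the two-sided translate
  have hinner : ∀ U : GaugeField P j G,
      ∫⁻ k, F U k ∂(fieldMeasure P (j + 1) G) = ∫⁻ k, I (φ U, Λ.piecewise k (Φ U)) ∂(fieldMeasure P (j + 1) G) := by
    intro U
    obtain ⟨A, B, hAB⟩ := comp_shear_mask_eq_piecewise hj t ht Λ hΦΛ hΦoff U
    have hT : MeasurePreserving (fun (k : GaugeField P (j + 1) G) (c : PBond P (j + 1)) => A c * k c * B c)
        (fieldMeasure P (j + 1) G) (fieldMeasure P (j + 1) G) :=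
      (measurePreserving_mulRight B).comp (measurePreserving_mulLeft A)
    have hg : Measurable fun k : GaugeField P (j + 1) G => I (φ U, Λ.piecewise k (Φ U)) :=
      hIm.comp (measurable_const.prodMk (measurable_piecewise_overwrite Λ measurable_const measurable_id))
    have h1 : ∀ k : GaugeField P (j + 1) G, F U k = I (φ U, Λ.piecewise (fun c => A c * k c * B c) (Φ U)) := by
      intro k
      simp only [hF, hAB k]
    simp_rw [h1]
    exact hT.lintegral_comp hg
  -- (iv) assemble (Tonelli twice)
  calc ∫⁻ a, I a ∂(ν.map fun U => (φ U, Φ U))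
      = ∫⁻ U, I (φ U, Φ U) ∂ν := lintegral_map hIm hpair
    _ = ∫⁻ k, ∫⁻ U, F U k ∂ν ∂(fieldMeasure P (j + 1) G) := havg
    _ = ∫⁻ U, ∫⁻ k, F U k ∂(fieldMeasure P (j + 1) G) ∂ν := lintegral_lintegral_swap hFm'.aemeasurable
    _ = ∫⁻ U, ∫⁻ k, I (φ U, Λ.piecewise k (Φ U)) ∂(fieldMeasure P (j + 1) G) ∂ν := lintegral_congr hinner
    _ = ∫⁻ p, I (φ p.1, Λ.piecewise p.2 (Φ p.1)) ∂(ν.prod (fieldMeasure P (j + 1) G)) :=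
        (lintegral_prod _ (hIm.comp hover).aemeasurable).symm
    _ = _ := (lintegral_map hIm hover).symm

/-- ★★ **THE RIGHT-HAND SIDE THROUGH THE OFF-`Λ` MARGINAL**: the overwrite law depends on `ν` only through the law of `(φ U, Λ.piecewise 1 (Φ U))` (the spectator and
the non-laundered coordinates, the laundered ones blanked to `1`). [cite: Balaban1987RG1, (0.4) p.253; Balaban1985Averaging, (10) p.19] -/
theorem map_prod_eq_overwrite_marginal (ν : Measure (GaugeField P j G)) [SFinite ν]
    (hν : ∀ k : GaugeField P (j + 1) G,
      ν.map (fun U b => U b * Function.extend (fun c : PBond P (j + 1) => line c (t c)) (Λ.mulIndicator k) (fun _ => 1) b) = ν)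
    {φ : GaugeField P j G → Y} (hφ : Measurable φ)
    (hφoff : ∀ U U' : GaugeField P j G, (∀ b, (¬ ∃ c ∈ Λ, line c (t c) = b) → U b = U' b) → φ U = φ U') :
    ν.map (fun U => (φ U, Φ U)) =
      ((((ν.map fun U => (φ U, Λ.piecewise 1 (Φ U))) : Measure (Y × GaugeField P (j + 1) G)).prod
          (fieldMeasure P (j + 1) G)).map
        (fun q : (Y × GaugeField P (j + 1) G) × GaugeField P (j + 1) G => (q.1.1, Λ.piecewise q.2 q.1.2)) :
          Measure (Y × GaugeField P (j + 1) G)) := by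
  have hblank : @Measurable (GaugeField P j G) (Y × GaugeField P (j + 1) G) _ _ fun U => (φ U, Λ.piecewise 1 (Φ U)) :=
    hφ.prodMk (measurable_piecewise_overwrite Λ hΦ measurable_const)
  have hG : @Measurable ((Y × GaugeField P (j + 1) G) × GaugeField P (j + 1) G) (Y × GaugeField P (j + 1) G) _ _
      fun q => (q.1.1, Λ.piecewise q.2 q.1.2) :=
    (measurable_fst.comp measurable_fst).prodMk
      (measurable_piecewise_overwrite Λ (measurable_snd.comp measurable_fst) measurable_snd)
  -- the composite is the overwrite (`Λ.piecewise k (Λ.piecewise 1 V) = Λ.piecewise k V`)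
  have hcomp : ((fun q : (Y × GaugeField P (j + 1) G) × GaugeField P (j + 1) G =>
          ((q.1.1, Λ.piecewise q.2 q.1.2) : Y × GaugeField P (j + 1) G)) ∘
        Prod.map (fun U : GaugeField P j G => ((φ U, Λ.piecewise 1 (Φ U)) : Y × GaugeField P (j + 1) G)) id) =
      fun p : GaugeField P j G × GaugeField P (j + 1) G => ((φ p.1, Λ.piecewise p.2 (Φ p.1)) : Y × GaugeField P (j + 1) G) := by
    funext p
    obtain ⟨U, k⟩ := p
    show ((φ U, Λ.piecewise k (Λ.piecewise 1 (Φ U))) : Y × GaugeField P (j + 1) G) = (φ U, Λ.piecewise k (Φ U))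
    congr 1
    funext c
    by_cases hc : c ∈ Λ
    · rw [Set.piecewise_eq_of_mem _ _ _ hc, Set.piecewise_eq_of_mem _ _ _ hc]
    · rw [Set.piecewise_eq_of_notMem _ _ _ hc, Set.piecewise_eq_of_notMem _ _ _ hc, Set.piecewise_eq_of_notMem _ _ _ hc]
  calc ν.map (fun U => (φ U, Φ U))
      = (ν.prod (fieldMeasure P (j + 1) G)).map
          (fun p : GaugeField P j G × GaugeField P (j + 1) G => ((φ p.1, Λ.piecewise p.2 (Φ p.1)) : Y × GaugeField P (j + 1) G)) :=
        map_prod_eq_overwrite hj t ht Λ hΦ hΦΛ hΦoff ν hν hφ hφoff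
    _ = ((ν.prod (fieldMeasure P (j + 1) G)).map
          (Prod.map (fun U : GaugeField P j G => ((φ U, Λ.piecewise 1 (Φ U)) : Y × GaugeField P (j + 1) G)) id)).map
          (fun q : (Y × GaugeField P (j + 1) G) × GaugeField P (j + 1) G =>
            ((q.1.1, Λ.piecewise q.2 q.1.2) : Y × GaugeField P (j + 1) G)) := by
        rw [Measure.map_map hG (hblank.prodMap measurable_id), hcomp]
    _ = _ := by rw [← Measure.map_prod_map _ _ hblank measurable_id, Measure.map_id]

/-- ★★ **COUPLING**: two s-finite laws on the level-`j` fields, both invariant under the masked shear, with the SAME law of `(φ U, Λ.piecewise 1 (Φ U))` — the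
spectator and the non-laundered coordinates — have the same law of `(φ U, Φ U)`.  With `ν₁ = (Ū^{S∪{x}})_*ρ`, `ν₂ = (Ū^S)_*ρ` (two laws agreeing off the bond `x`,
§0) and `Λ ∋` the segment through `x`: «the one-site defect dies one level up». [cite: Balaban1987RG1, (0.4) p.253; Balaban1985Averaging, (b) p.23] -/
theorem map_prod_eq_of_marginal_eq (ν₁ ν₂ : Measure (GaugeField P j G)) [SFinite ν₁] [SFinite ν₂]
    (hν₁ : ∀ k : GaugeField P (j + 1) G,
      ν₁.map (fun U b => U b * Function.extend (fun c : PBond P (j + 1) => line c (t c)) (Λ.mulIndicator k) (fun _ => 1) b) = ν₁)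
    (hν₂ : ∀ k : GaugeField P (j + 1) G,
      ν₂.map (fun U b => U b * Function.extend (fun c : PBond P (j + 1) => line c (t c)) (Λ.mulIndicator k) (fun _ => 1) b) = ν₂)
    {φ : GaugeField P j G → Y} (hφ : Measurable φ)
    (hφoff : ∀ U U' : GaugeField P j G, (∀ b, (¬ ∃ c ∈ Λ, line c (t c) = b) → U b = U' b) → φ U = φ U')
    (hmarg : (ν₁.map (fun U => (φ U, Λ.piecewise 1 (Φ U))) : Measure (Y × GaugeField P (j + 1) G)) =
      ν₂.map (fun U => (φ U, Λ.piecewise 1 (Φ U)))) :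
    ν₁.map (fun U => (φ U, Φ U)) = ν₂.map (fun U => (φ U, Φ U)) :=
  (map_prod_eq_overwrite_marginal hj t ht Λ hΦ hΦΛ hΦoff ν₁ hν₁ hφ hφoff).trans
    ((congrArg (fun μ : Measure (Y × GaugeField P (j + 1) G) => ((μ.prod (fieldMeasure P (j + 1) G)).map
        (fun q : (Y × GaugeField P (j + 1) G) × GaugeField P (j + 1) G =>
          ((q.1.1, Λ.piecewise q.2 q.1.2) : Y × GaugeField P (j + 1) G)) : Measure (Y × GaugeField P (j + 1) G))) hmarg).trans
      (map_prod_eq_overwrite_marginal hj t ht Λ hΦ hΦΛ hΦoff ν₂ hν₂ hφ hφoff).symm)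

/-- **NO SPECTATOR**: `ν.map Φ = (ν ⊗ dU_{j+1}).map ((U, k) ↦ Λ.piecewise k (Φ U))`. [cite: Balaban1987RG1, (0.4) p.253; Balaban1985Averaging, (10) p.19] -/
theorem map_eq_overwrite (ν : Measure (GaugeField P j G)) [SFinite ν]
    (hν : ∀ k : GaugeField P (j + 1) G,
      ν.map (fun U b => U b * Function.extend (fun c : PBond P (j + 1) => line c (t c)) (Λ.mulIndicator k) (fun _ => 1) b) = ν) :
    ν.map Φ = ((ν.prod (fieldMeasure P (j + 1) G)).map
      (fun p : GaugeField P j G × GaugeField P (j + 1) G => Λ.piecewise p.2 (Φ p.1)) : Measure (GaugeField P (j + 1) G)) := by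
  have h := map_prod_eq_overwrite hj t ht Λ hΦ hΦΛ hΦoff ν hν (Y := Unit) (φ := fun _ => ()) measurable_const (fun _ _ _ => rfl)
  have hpair : Measurable fun U : GaugeField P j G => ((), Φ U) := measurable_const.prodMk hΦ
  have hover : @Measurable (GaugeField P j G × GaugeField P (j + 1) G) (Unit × GaugeField P (j + 1) G) _ _
      fun p => ((), Λ.piecewise p.2 (Φ p.1)) :=
    measurable_const.prodMk (measurable_piecewise_overwrite Λ (hΦ.comp measurable_fst) measurable_snd)
  calc ν.map Φ = ν.map (Prod.snd ∘ fun U : GaugeField P j G => ((), Φ U)) := rfl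
    _ = (ν.map fun U : GaugeField P j G => ((), Φ U)).map Prod.snd := (Measure.map_map measurable_snd hpair).symm
    _ = (((ν.prod (fieldMeasure P (j + 1) G)).map fun p : GaugeField P j G × GaugeField P (j + 1) G =>
          (((), Λ.piecewise p.2 (Φ p.1)) : Unit × GaugeField P (j + 1) G)) : Measure (Unit × GaugeField P (j + 1) G)).map Prod.snd :=
        congrArg (fun μ : Measure (Unit × GaugeField P (j + 1) G) => μ.map Prod.snd) h
    _ = (ν.prod (fieldMeasure P (j + 1) G)).map (Prod.snd ∘ fun p : GaugeField P j G × GaugeField P (j + 1) G =>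
          (((), Λ.piecewise p.2 (Φ p.1)) : Unit × GaugeField P (j + 1) G)) := Measure.map_map measurable_snd hover
    _ = _ := rfl

/-- **COUPLING, NO SPECTATOR**: equal laws of the blanked image `Λ.piecewise 1 (Φ U)` ⇒ equal laws of `Φ U`. [cite: Balaban1987RG1, (0.4) p.253; Balaban1985Averaging, (b) p.23] -/
theorem map_eq_of_marginal_eq (ν₁ ν₂ : Measure (GaugeField P j G)) [SFinite ν₁] [SFinite ν₂]
    (hν₁ : ∀ k : GaugeField P (j + 1) G,
      ν₁.map (fun U b => U b * Function.extend (fun c : PBond P (j + 1) => line c (t c)) (Λ.mulIndicator k) (fun _ => 1) b) = ν₁)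
    (hν₂ : ∀ k : GaugeField P (j + 1) G,
      ν₂.map (fun U b => U b * Function.extend (fun c : PBond P (j + 1) => line c (t c)) (Λ.mulIndicator k) (fun _ => 1) b) = ν₂)
    (hmarg : (ν₁.map (fun U => Λ.piecewise 1 (Φ U)) : Measure (GaugeField P (j + 1) G)) = ν₂.map (fun U => Λ.piecewise 1 (Φ U))) :
    ν₁.map Φ = ν₂.map Φ := by
  have hblank : @Measurable (GaugeField P j G) (GaugeField P (j + 1) G) _ _ fun U => Λ.piecewise 1 (Φ U) :=
    measurable_piecewise_overwrite Λ hΦ measurable_const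
  have hpair : @Measurable (GaugeField P (j + 1) G) (Unit × GaugeField P (j + 1) G) _ _ fun V => ((), V) :=
    measurable_const.prodMk measurable_id
  have hmarg' : (ν₁.map (fun U : GaugeField P j G => (((), Λ.piecewise 1 (Φ U)) : Unit × GaugeField P (j + 1) G)) :
        Measure (Unit × GaugeField P (j + 1) G)) =
      ν₂.map (fun U : GaugeField P j G => (((), Λ.piecewise 1 (Φ U)) : Unit × GaugeField P (j + 1) G)) :=
    calc _ = (ν₁.map fun U : GaugeField P j G => (Λ.piecewise 1 (Φ U) : GaugeField P (j + 1) G)).map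
          (fun V : GaugeField P (j + 1) G => (((), V) : Unit × GaugeField P (j + 1) G)) := (Measure.map_map hpair hblank).symm
      _ = (ν₂.map fun U : GaugeField P j G => (Λ.piecewise 1 (Φ U) : GaugeField P (j + 1) G)).map
          (fun V : GaugeField P (j + 1) G => (((), V) : Unit × GaugeField P (j + 1) G)) :=
          congrArg (fun μ : Measure (GaugeField P (j + 1) G) =>
            (μ.map fun V : GaugeField P (j + 1) G => (((), V) : Unit × GaugeField P (j + 1) G))) hmarg
      _ = _ := Measure.map_map hpair hblank
  have h := map_prod_eq_of_marginal_eq hj t ht Λ hΦ hΦΛ hΦoff ν₁ ν₂ hν₁ hν₂ (Y := Unit) (φ := fun _ => ()) measurable_const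
    (fun _ _ _ => rfl) hmarg'
  have hp : Measurable fun U : GaugeField P j G => ((), Φ U) := measurable_const.prodMk hΦ
  calc ν₁.map Φ = ν₁.map (Prod.snd ∘ fun U : GaugeField P j G => ((), Φ U)) := rfl
    _ = (ν₁.map fun U : GaugeField P j G => ((), Φ U)).map Prod.snd := (Measure.map_map measurable_snd hp).symm
    _ = (ν₂.map fun U : GaugeField P j G => ((), Φ U)).map Prod.snd :=
        congrArg (fun μ : Measure (Unit × GaugeField P (j + 1) G) => μ.map Prod.snd) h
    _ = ν₂.map (Prod.snd ∘ fun U : GaugeField P j G => ((), Φ U)) := Measure.map_map measurable_snd hp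
    _ = _ := rfl

end Overwrite

end Summit.QuantumFields.YangMills.Theorems.UV3AxialLaunderingOverwrite

end
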